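import Summits.BirchSwinnertonDyer.BirchSwinnertonDyer.Theorems.SylvesterTwoHeegnerIndexCoupledDescentCebotarevHSY
import HarnessLib

/-!
# Leaf (L3) of the coupled Kolyvagin descent — both clauses for `j = 0` curves at `p = 2`

Sequel of `SylvesterTwoHeegnerIndexCoupledDescentCebotarevHSY` (the per-curve package
`hsy_curve_package`, the semilinearity of `[ζ]`, input (Z) `hsy_exists_moving`); same crux
(`UpperOffV0HSYPlus`, stmt-BirchSwinnertonDyer-19804, skeleton VARIANT K — the binders `p`, `A`, `B`,
`C • B = cubeSumCurve p`, `C′ • A = cubeSumCurve (3p²)` of `stub_firstLayerFour` / `stub_firstLayerSeven`,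
rows k-p1/k-p2; here `A`, `B` denote the short models `C′ • A`, `C • B` base-changed to `K`), same
frame: two curves `A`, `B` over `ℚ` with `a₁ = … = a₄ = 0` (the short models of the stub's binders),
`K ∋ ζ` imaginary quadratic with conjugation `c`, `c ζ = ζ²`, the `[ζ]` data `φ`, `fn`, `hcoe` per
curve (the operator on `H¹(K, B_K[2])` being `wH := resH1Hom (ContinuousMonoidHom.id _) fnB hfnB`,
the tree's `H¹([ζ])`), and as the ONLY arithmetic inputs «`t³ + a₆ ≠ 0` on `K`» per curve and the
Kummer independence «`X³ + a₆(A)` rootless over `K(θ_B)`» / «`X³ + a₆(B)` rootless over `K(θ_A)`»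
(`K(A[2]) ≠ K(B[2])`). This file proves, for the pair at `p = 2`, clause (hL3a)
`infinite_kolyvaginPrimes_ne_hsy` and clause (hL3b) `infinite_kolyvaginPrimes_line_hsy` of
`SylvesterTwoCoupledDescent.selmerGroup_eq_bot_and_le_closure_of_coupledLeaves`, from the generic
`infinite_kolyvaginPrimes_ne` / `infinite_kolyvaginPrimes_line`; (hL3b) has the one extra displayed
input on the bottom class `y` (in the application `δY`): its `𝔽₄`-line `{a y + b wH y}` is
generated by a `σ`-FIXED class `x₁` (memo two §64 (C4)/(h4′): complex conjugation preserves
`𝒪·δY`). The lift of `c`, the twelve module data per curve, (Z) and Čebotarev are discharged. Nothing is asserted about 19804; no definition, no named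
fact, no `sorry`; BSD is not claimed.
-/

-- every Summits module is named `Summit.<Summit>.<Problem>…`: the duplicated component is by design
set_option linter.dupNamespace false

noncomputable section

open scoped Classical
open WeierstrassCurve NumberField IsDedekindDomain Field
open Literature.NumberTheory.EllipticCurves Literature.NumberTheory.GaloisRepresentations

namespace Summit.BirchSwinnertonDyer.BirchSwinnertonDyer.Theorems.SylvesterTwoCoupledDescentCebotarev

variable {K : Type} [Field K] [NumberField K]

/-! ## Clauses (hL3a) and (hL3b) for the pair -/

section Main

variable {A B : WeierstrassCurve ℚ} [A.IsElliptic] [B.IsElliptic]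

/-- **(hL3a) for two `j = 0` curves at `p = 2` over `K = ℚ(ζ)`** — the clause `ceb_ne` of
`SylvesterTwoCoupledDescent.selmerGroup_eq_bot_and_le_closure_of_coupledLeaves` for
`(A_K, B_K)`, `p = 2`: for any classes `s ∈ H¹(K, A_K[2])`, `t ∈ H¹(K, B_K[2])`, infinitely many
Kolyvagin primes `ℓ` (`ℓ ∤ N_A N_B d_K`, `ℓ ≠ 2`, `(ℓ)` prime in `𝓞 K`, `Frob(ℓ) = Frob(∞)` on `K(A_2)`
and `K(B_2)`) with `s_λ ≠ 0` if `s ≠ 0` and `t_λ ≠ 0` if `t ≠ 0`. DISPLAYED: the curves' short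
models (`a₁ = … = a₄ = 0`; in the stub's binders `A`, `B` these are `C′ • A`, `C • B` with
`C • B = cubeSumCurve p`, `C′ • A = cubeSumCurve (3p²)`), `ζ ∈ K` with `c ζ = ζ²`, the `[ζ]` data
`φ`, `fn`, `hcoe` per curve, «`t³ + a₆ ≠ 0` on `K`» per curve, and the Kummer independence
«`X³ + a₆(A)` has no root in `K(θ)` for every root `θ` of `X³ + a₆(B)`» and symmetrically
(`K(A[2]) ≠ K(B[2])`; for HSY `9/2` is not a cube). Everything else — the lift of `c`, the twelve
module data (`hsy_curve_package`), (Z) (`hsy_exists_moving`), Čebotarev — is discharged.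
[cite: McCallumLMS1991, §3 Cor. 3.2 (proof)] -/
theorem infinite_kolyvaginPrimes_ne_hsy {NA NB : ℕ} [NeZero NA] [NeZero NB]
    (hK : IsImaginaryQuadratic K) {ζ : K} (hζ : IsPrimitiveRoot ζ 3) {c : K ≃ₐ[ℚ] K}
    (hcζ : c ζ = ζ ^ 2)
    -- curve `A`
    (hA1 : A.a₁ = 0) (hA2 : A.a₂ = 0) (hA3 : A.a₃ = 0) (hA4 : A.a₄ = 0)
    (hA6 : ∀ t : K, t ^ 3 + algebraMap ℚ K A.a₆ ≠ 0)
    (φA : geomPoints (A.baseChange K) →+ geomPoints (A.baseChange K))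
    (hφArel : ∀ P, φA (φA P) + φA P + P = 0)
    (hφA : ∀ (x y : AlgebraicClosure K)
      (h : ((A.baseChange K).baseChange (AlgebraicClosure K)).toAffine.Nonsingular x y),
      ∃ h', φA (Affine.Point.some x y h) =
        Affine.Point.some (algebraMap K (AlgebraicClosure K) ζ ^ 2 * x) y h')
    (fnA : geomTorsion (A.baseChange K) ((2 : ℕ) : ℤ) →+ geomTorsion (A.baseChange K) ((2 : ℕ) : ℤ))
    (hfnA : ∀ (σ : absoluteGaloisGroup K) (P : geomTorsion (A.baseChange K) ((2 : ℕ) : ℤ)),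
      fnA (ContinuousMonoidHom.id _ σ • P) = σ • fnA P)
    (hcoeA : ∀ P : geomTorsion (A.baseChange K) ((2 : ℕ) : ℤ),
      ((fnA P : geomTorsion (A.baseChange K) ((2 : ℕ) : ℤ)) : geomPoints (A.baseChange K)) = φA P)
    (hZA : ∀ θ : AlgebraicClosure K, θ ^ 3 + algebraMap ℚ (AlgebraicClosure K) B.a₆ = 0 →
      ∀ t : AlgebraicClosure K, t ∈ IntermediateField.adjoin K {θ} →
        t ^ 3 + algebraMap ℚ (AlgebraicClosure K) A.a₆ ≠ 0)
    -- curve `B`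
    (hB1 : B.a₁ = 0) (hB2 : B.a₂ = 0) (hB3 : B.a₃ = 0) (hB4 : B.a₄ = 0)
    (hB6 : ∀ t : K, t ^ 3 + algebraMap ℚ K B.a₆ ≠ 0)
    (φB : geomPoints (B.baseChange K) →+ geomPoints (B.baseChange K))
    (hφBrel : ∀ P, φB (φB P) + φB P + P = 0)
    (hφB : ∀ (x y : AlgebraicClosure K)
      (h : ((B.baseChange K).baseChange (AlgebraicClosure K)).toAffine.Nonsingular x y),
      ∃ h', φB (Affine.Point.some x y h) =
        Affine.Point.some (algebraMap K (AlgebraicClosure K) ζ ^ 2 * x) y h')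
    (fnB : geomTorsion (B.baseChange K) ((2 : ℕ) : ℤ) →+ geomTorsion (B.baseChange K) ((2 : ℕ) : ℤ))
    (hfnB : ∀ (σ : absoluteGaloisGroup K) (P : geomTorsion (B.baseChange K) ((2 : ℕ) : ℤ)),
      fnB (ContinuousMonoidHom.id _ σ • P) = σ • fnB P)
    (hcoeB : ∀ P : geomTorsion (B.baseChange K) ((2 : ℕ) : ℤ),
      ((fnB P : geomTorsion (B.baseChange K) ((2 : ℕ) : ℤ)) : geomPoints (B.baseChange K)) = φB P)
    (hZB : ∀ θ : AlgebraicClosure K, θ ^ 3 + algebraMap ℚ (AlgebraicClosure K) A.a₆ = 0 →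
      ∀ t : AlgebraicClosure K, t ∈ IntermediateField.adjoin K {θ} →
        t ^ 3 + algebraMap ℚ (AlgebraicClosure K) B.a₆ ≠ 0)
    (s : galH1Torsion (A.baseChange K) ((2 : ℕ) : ℤ))
    (t : galH1Torsion (B.baseChange K) ((2 : ℕ) : ℤ)) :
    Set.Infinite {ℓ : ℕ | (ℓ.Prime ∧ ¬ ℓ ∣ NA ∧ ¬ ℓ ∣ NB ∧ ¬ ((ℓ : ℤ) ∣ NumberField.discr K) ∧
        ℓ ≠ 2 ∧ (Ideal.span {(ℓ : 𝓞 K)}).IsPrime ∧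
        FrobEqFrobInfty A K 2 ℓ ∧ FrobEqFrobInfty B K 2 ℓ) ∧
      ∀ v : HeightOneSpectrum (𝓞 K), (ℓ : 𝓞 K) ∈ v.asIdeal →
        (s ≠ 0 → s ∉ (A.baseChange K).torsionLocalKer (v.adicCompletion K) ((2 : ℕ) : ℤ)) ∧
        (t ≠ 0 → t ∉ (B.baseChange K).torsionLocalKer (v.adicCompletion K) ((2 : ℕ) : ℤ))} := by
  -- the lift `τ = e c₀ e⁻¹` of `c` (`c ≠ 1` since `c ζ = ζ² ≠ ζ`)
  have hc : c ≠ 1 := by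
    intro h
    rw [h, AlgEquiv.one_apply] at hcζ
    have hζ1 : ζ ≠ 1 := hζ.ne_one (by norm_num)
    have hζ0 : ζ ≠ 0 := hζ.ne_zero (by norm_num)
    apply hζ1
    have : ζ * (ζ - 1) = 0 := by linear_combination hcζ.symm
    rcases mul_eq_zero.mp this with h0 | h1
    · exact absurd h0 hζ0
    · linear_combination h1
  obtain ⟨c₀, hc₀⟩ := exists_isComplexConjugation (Rat.castHom ℝ)
  have ht : IsLiftOfAut c (absGaloisTransport (K := ℚ) (L := K) c₀).toRingEquiv :=
    RatClosure.isLiftOfAut_absGaloisTransport_of_isImaginaryQuadratic hK hc hc₀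
  have hinv : ∀ x, (absGaloisTransport (K := ℚ) (L := K) c₀).toRingEquiv
      ((absGaloisTransport (K := ℚ) (L := K) c₀).toRingEquiv x) = x := fun x ↦
    RatClosure.absGaloisTransport_absGaloisTransport_of_sq_eq_one hc₀.sq_eq_one x
  -- the two packages
  obtain ⟨hSA, hw3A, hCA, hcommA, ⟨zA₀, hιA⟩, hιAg, hwH2A, hwHA, hσwA, hτwA, hpow3A, h3A,
    ⟨eA', hindEA⟩⟩ :=
    hsy_curve_package A hA1 hA2 hA3 hA4 hζ hcζ ht hinv hA6 φA hφArel hφA fnA hfnA hcoeA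
  obtain ⟨hSB, hw3B, hCB, hcommB, ⟨zB₀, hιB⟩, hιBg, hwH2B, hwHB, hσwB, hτwB, hpow3B, h3B,
    ⟨eB', hindEB⟩⟩ :=
    hsy_curve_package B hB1 hB2 hB3 hB4 hζ hcζ ht hinv hB6 φB hφBrel hφB fnB hfnB hcoeB
  obtain ⟨zA, hzA, hzAsurj⟩ :=
    hsy_exists_moving A B hA1 hA2 hA3 hA4 hB1 hB2 hB3 hB4 hζ hZA φA hφArel hφA fnA hcoeA
  obtain ⟨zB, hzB, hzBsurj⟩ :=
    hsy_exists_moving B A hB1 hB2 hB3 hB4 hA1 hA2 hA3 hA4 hζ hZB φB hφBrel hφB fnB hcoeB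
  exact infinite_kolyvaginPrimes_ne (NA := NA) (NB := NB) hK Nat.prime_two (by norm_num) hc₀ ht
    hSA fnA hw3A hCA hcommA fnA hιA hιAg (resH1Hom (ContinuousMonoidHom.id _) fnA hfnA) hwH2A hwHA
    hσwA hτwA hpow3B h3A hzA hzAsurj eA' hindEA
    hSB fnB hw3B hCB hcommB fnB hιB hιBg (resH1Hom (ContinuousMonoidHom.id _) fnB hfnB) hwH2B hwHB
    hσwB hτwB hpow3A h3B hzB hzBsurj eB' hindEB s t


/-- **(hL3b) for two `j = 0` curves at `p = 2` over `K = ℚ(ζ)`** — the clause `ceb_line` of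
`SylvesterTwoCoupledDescent.selmerGroup_eq_bot_and_le_closure_of_coupledLeaves` for `(A_K, B_K)`,
`p = 2`, `w = H¹([ζ]) = resH1Hom (ContinuousMonoidHom.id _) fnB hfnB`: for a class `y` of `B_K`
whose `𝔽₄`-line is generated by a `σ`-fixed class `x₁` (`y = α x₁ + β w x₁`,
`ℤ x₁ + ℤ w x₁ ⊆ ℤ y + ℤ w y`), every class `s` OFF the line `{a y + b w y}` and every `c ≠ 0` in
`H¹(K, A_K[2])`, there are infinitely many Kolyvagin primes `ℓ` (`ℓ ∤ N_A N_B d_K`, `ℓ ≠ 2`, `(ℓ)`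
prime, `Frob(ℓ) = Frob(∞)` on `K(A_2)` and `K(B_2)`) with `y_λ = 0`, `s_λ ≠ 0`, `c_λ ≠ 0` at
`λ ∋ ℓ`. Displayed: as in `infinite_kolyvaginPrimes_ne_hsy`, plus `x₁` and the two line relations.
[cite: McCallumLMS1991, §3 Cor. 3.2 (proof)] -/
theorem infinite_kolyvaginPrimes_line_hsy {NA NB : ℕ} [NeZero NA] [NeZero NB]
    (hK : IsImaginaryQuadratic K) {ζ : K} (hζ : IsPrimitiveRoot ζ 3) {c : K ≃ₐ[ℚ] K}
    (hcζ : c ζ = ζ ^ 2)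
    -- curve `A`
    (hA1 : A.a₁ = 0) (hA2 : A.a₂ = 0) (hA3 : A.a₃ = 0) (hA4 : A.a₄ = 0)
    (hA6 : ∀ t : K, t ^ 3 + algebraMap ℚ K A.a₆ ≠ 0)
    (φA : geomPoints (A.baseChange K) →+ geomPoints (A.baseChange K))
    (hφArel : ∀ P, φA (φA P) + φA P + P = 0)
    (hφA : ∀ (x y : AlgebraicClosure K)
      (h : ((A.baseChange K).baseChange (AlgebraicClosure K)).toAffine.Nonsingular x y),
      ∃ h', φA (Affine.Point.some x y h) =
        Affine.Point.some (algebraMap K (AlgebraicClosure K) ζ ^ 2 * x) y h')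
    (fnA : geomTorsion (A.baseChange K) ((2 : ℕ) : ℤ) →+ geomTorsion (A.baseChange K) ((2 : ℕ) : ℤ))
    (hfnA : ∀ (σ : absoluteGaloisGroup K) (P : geomTorsion (A.baseChange K) ((2 : ℕ) : ℤ)),
      fnA (ContinuousMonoidHom.id _ σ • P) = σ • fnA P)
    (hcoeA : ∀ P : geomTorsion (A.baseChange K) ((2 : ℕ) : ℤ),
      ((fnA P : geomTorsion (A.baseChange K) ((2 : ℕ) : ℤ)) : geomPoints (A.baseChange K)) = φA P)
    (hZA : ∀ θ : AlgebraicClosure K, θ ^ 3 + algebraMap ℚ (AlgebraicClosure K) B.a₆ = 0 →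
      ∀ t : AlgebraicClosure K, t ∈ IntermediateField.adjoin K {θ} →
        t ^ 3 + algebraMap ℚ (AlgebraicClosure K) A.a₆ ≠ 0)
    -- curve `B`
    (hB1 : B.a₁ = 0) (hB2 : B.a₂ = 0) (hB3 : B.a₃ = 0) (hB4 : B.a₄ = 0)
    (hB6 : ∀ t : K, t ^ 3 + algebraMap ℚ K B.a₆ ≠ 0)
    (φB : geomPoints (B.baseChange K) →+ geomPoints (B.baseChange K))
    (hφBrel : ∀ P, φB (φB P) + φB P + P = 0)
    (hφB : ∀ (x y : AlgebraicClosure K)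
      (h : ((B.baseChange K).baseChange (AlgebraicClosure K)).toAffine.Nonsingular x y),
      ∃ h', φB (Affine.Point.some x y h) =
        Affine.Point.some (algebraMap K (AlgebraicClosure K) ζ ^ 2 * x) y h')
    (fnB : geomTorsion (B.baseChange K) ((2 : ℕ) : ℤ) →+ geomTorsion (B.baseChange K) ((2 : ℕ) : ℤ))
    (hfnB : ∀ (σ : absoluteGaloisGroup K) (P : geomTorsion (B.baseChange K) ((2 : ℕ) : ℤ)),
      fnB (ContinuousMonoidHom.id _ σ • P) = σ • fnB P)
    (hcoeB : ∀ P : geomTorsion (B.baseChange K) ((2 : ℕ) : ℤ),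
      ((fnB P : geomTorsion (B.baseChange K) ((2 : ℕ) : ℤ)) : geomPoints (B.baseChange K)) = φB P)
    (hZB : ∀ θ : AlgebraicClosure K, θ ^ 3 + algebraMap ℚ (AlgebraicClosure K) A.a₆ = 0 →
      ∀ t : AlgebraicClosure K, t ∈ IntermediateField.adjoin K {θ} →
        t ^ 3 + algebraMap ℚ (AlgebraicClosure K) B.a₆ ≠ 0)
    -- the bottom class and its `σ`-fixed generator
    (y x₁ : galH1Torsion (B.baseChange K) ((2 : ℕ) : ℤ))
    (hx₁ : conjAct B c ((2 : ℕ) : ℤ) x₁ = x₁)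
    (hyx : ∃ α β : ℤ, y = α • x₁ + β • resH1Hom (ContinuousMonoidHom.id _) fnB hfnB x₁)
    (hxy : ∀ a b : ℤ, ∃ a' b' : ℤ,
      a • x₁ + b • resH1Hom (ContinuousMonoidHom.id _) fnB hfnB x₁ =
        a' • y + b' • resH1Hom (ContinuousMonoidHom.id _) fnB hfnB y)
    (s : galH1Torsion (B.baseChange K) ((2 : ℕ) : ℤ))
    (hs : ¬ ∃ a b : ℤ, s = a • y + b • resH1Hom (ContinuousMonoidHom.id _) fnB hfnB y)
    (cl : galH1Torsion (A.baseChange K) ((2 : ℕ) : ℤ)) (hcl : cl ≠ 0) :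
    Set.Infinite {ℓ : ℕ | (ℓ.Prime ∧ ¬ ℓ ∣ NA ∧ ¬ ℓ ∣ NB ∧ ¬ ((ℓ : ℤ) ∣ NumberField.discr K) ∧
        ℓ ≠ 2 ∧ (Ideal.span {(ℓ : 𝓞 K)}).IsPrime ∧
        FrobEqFrobInfty A K 2 ℓ ∧ FrobEqFrobInfty B K 2 ℓ) ∧
      ∀ v : HeightOneSpectrum (𝓞 K), (ℓ : 𝓞 K) ∈ v.asIdeal →
        y ∈ (B.baseChange K).torsionLocalKer (v.adicCompletion K) ((2 : ℕ) : ℤ) ∧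
        s ∉ (B.baseChange K).torsionLocalKer (v.adicCompletion K) ((2 : ℕ) : ℤ) ∧
        cl ∉ (A.baseChange K).torsionLocalKer (v.adicCompletion K) ((2 : ℕ) : ℤ)} := by
  -- the lift `τ = e c₀ e⁻¹` of `c` (`c ≠ 1` since `c ζ = ζ² ≠ ζ`)
  have hc : c ≠ 1 := by
    intro h
    rw [h, AlgEquiv.one_apply] at hcζ
    have hζ1 : ζ ≠ 1 := hζ.ne_one (by norm_num)
    have hζ0 : ζ ≠ 0 := hζ.ne_zero (by norm_num)
    apply hζ1
    have : ζ * (ζ - 1) = 0 := by linear_combination hcζ.symm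
    rcases mul_eq_zero.mp this with h0 | h1
    · exact absurd h0 hζ0
    · linear_combination h1
  obtain ⟨c₀, hc₀⟩ := exists_isComplexConjugation (Rat.castHom ℝ)
  have ht : IsLiftOfAut c (absGaloisTransport (K := ℚ) (L := K) c₀).toRingEquiv :=
    RatClosure.isLiftOfAut_absGaloisTransport_of_isImaginaryQuadratic hK hc hc₀
  have hinv : ∀ x, (absGaloisTransport (K := ℚ) (L := K) c₀).toRingEquiv
      ((absGaloisTransport (K := ℚ) (L := K) c₀).toRingEquiv x) = x := fun x ↦
    RatClosure.absGaloisTransport_absGaloisTransport_of_sq_eq_one hc₀.sq_eq_one x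
  -- the two packages
  obtain ⟨hSA, hw3A, hCA, hcommA, ⟨zA₀, hιA⟩, hιAg, hwH2A, hwHA, hσwA, hτwA, hpow3A, h3A,
    ⟨eA', hindEA⟩⟩ :=
    hsy_curve_package A hA1 hA2 hA3 hA4 hζ hcζ ht hinv hA6 φA hφArel hφA fnA hfnA hcoeA
  obtain ⟨hSB, hw3B, hCB, hcommB, ⟨zB₀, hιB⟩, hιBg, hwH2B, hwHB, hσwB, hτwB, hpow3B, h3B,
    ⟨eB', hindEB⟩⟩ :=
    hsy_curve_package B hB1 hB2 hB3 hB4 hζ hcζ ht hinv hB6 φB hφBrel hφB fnB hfnB hcoeB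
  obtain ⟨zA, hzA, hzAsurj⟩ :=
    hsy_exists_moving A B hA1 hA2 hA3 hA4 hB1 hB2 hB3 hB4 hζ hZA φA hφArel hφA fnA hcoeA
  obtain ⟨zB, hzB, hzBsurj⟩ :=
    hsy_exists_moving B A hB1 hB2 hB3 hB4 hA1 hA2 hA3 hA4 hζ hZB φB hφBrel hφB fnB hcoeB
  exact infinite_kolyvaginPrimes_line (NA := NA) (NB := NB) hK Nat.prime_two (by norm_num) hc₀ ht
    hSA fnA hw3A hCA hcommA fnA hιA hιAg (resH1Hom (ContinuousMonoidHom.id _) fnA hfnA) hwH2A hwHA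
    hσwA hτwA hpow3B h3A hzA hzAsurj eA' hindEA
    hSB fnB hw3B hCB hcommB fnB hιB hιBg (resH1Hom (ContinuousMonoidHom.id _) fnB hfnB) hwH2B hwHB
    hσwB hτwB hpow3A h3B hzB hzBsurj eB' hindEB y x₁ hx₁ hyx hxy s hs cl hcl

end Main

end Summit.BirchSwinnertonDyer.BirchSwinnertonDyer.Theorems.SylvesterTwoCoupledDescentCebotarev

end
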